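import Summits.FinalStateConjecture.FinalStateConjecture.Theorems.ClusterCompletenessOmegaLimitMultiKerrVacuumLimit
import Literature.Geometry.Lorentzian.SpacetimeChartDeviationTransfer
import HarnessLib

/-!
# Route ClusterCompleteness · crux `OmegaLimitMultiKerr` — a development that converges in era
# gauge converges to a STATIONARY end

Structure lemma for the crux stmt-FinalStateConjecture-14664 (`ClusterCompleteness.OmegaLimitMultiKerr`),
line `Sketch`, lead gen 6 (registered main theorem
`translate_eq_self_of_tendsto_supCkENorm_translate_sub`, closed form).

In the `Cᵏ_loc`-translate currency of the line (field `h : E → W`, domain `O` invariant under the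
Killing translation `x ↦ x + s • e`, translates `h (· + t • e)`): IF the translates CONVERGE as
`t → +∞` (real time) to a field `g₀` — `supCkENorm K k (h (· + t • e) − g₀) → 0` on every compact
`K ⊆ O`, the conclusion of `…UniqueLimitConvergence` / `…IsolatedLimitConvergence` /
`…RecurrenceSelfImproves` — THEN `g₀` is STATIONARY in era gauge: `g₀ (x + s • e) = g₀ x` for all
`x ∈ O`, `s ∈ ℝ`. Proof: pointwise, `h (x + t • e) → g₀ x` and
`h (x + s • e + t • e) = h (x + (s + t) • e) → g₀ (x + s • e)`, while the second family is the
first along `t ↦ s + t → +∞`; limits in `W` are unique. No openness, smoothness or tameness is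
needed (only the order-`0` part of the sup norms is used, `tendsto_of_tendsto_supCkENorm_sub`).

Reading for the crux: the end state of any development that SETTLES IN ERA GAUGE (unique dark
limit) is invariant under the reference Killing time — so the identification of such an end is a
matter of STATIONARY vacuum rigidity (no-hair) alone; the Birkhoff/LaSalle inputs (P1)/(P1′) are
needed only to get from recurrence to stationarity of the dark limits. Hale 1980, Ch. I §8
(ω-limit sets are invariant; a one-point ω-limit set is a rest point). Everything is proved;
Mathlib + landed `Theorems` files only, no definitions.
-/

-- every `Summit.FinalStateConjecture.FinalStateConjecture.…` name repeats the summit = sub-problem segment (D-0017 layout)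
set_option linter.dupNamespace false

noncomputable section

open Set Filter Topology Function
open scoped ContDiff Topology ENNReal

namespace Summit.FinalStateConjecture.FinalStateConjecture.Theorems.ClusterCompleteness

open Literature.Geometry.Lorentzian

/-- **Registered structure stub (crux stmt-FinalStateConjecture-14664, line `Sketch`, stub
`ConvergentLimitStationary`): a `Cᵏ_loc`-limit of the late-time translates along REAL time is
translation-invariant.** Let `O ⊆ E` be invariant under `x ↦ x + s • e` and suppose
`supCkENorm K k (h (· + t • e) − g₀) → 0` as `t → +∞` for every compact `K ⊆ O`. Then
`g₀ (x + s • e) = g₀ x` for all `x ∈ O` and `s ∈ ℝ`: a development that converges in era gauge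
converges to a STATIONARY end (a one-point ω-limit set is a rest point of the flow; Hale 1980,
Ch. I §8, Thm. 8.1 with Lemma 8.2). Only the order-`0` part of the sup norms on singletons is used.
Closed form. [cite: Hale1980, Ch. I §8 Thm. 8.1] -/
theorem translate_eq_self_of_tendsto_supCkENorm_translate_sub :
    ∀ {E : Type*} [NormedAddCommGroup E] [NormedSpace ℝ E]
      {W : Type*} [NormedAddCommGroup W] [NormedSpace ℝ W]
      {O : Set E} {e : E}, (∀ x ∈ O, ∀ s : ℝ, x + s • e ∈ O) →
      ∀ {k : ℕ} {h g₀ : E → W},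
      (∀ K ⊆ O, IsCompact K →
        Tendsto (fun t : ℝ ↦ supCkENorm K k (fun x ↦ h (x + t • e) - g₀ x)) atTop (𝓝 0)) →
      ∀ x ∈ O, ∀ s : ℝ, g₀ (x + s • e) = g₀ x := by
  intro E _ _ W _ _ O e hOe k h g₀ hconv x hx s
  -- `h (x + t • e) → g₀ x`
  have h1 : Tendsto (fun t : ℝ ↦ h (x + t • e)) atTop (𝓝 (g₀ x)) :=
    tendsto_of_tendsto_supCkENorm_sub (f := fun (t : ℝ) (y : E) ↦ h (y + t • e)) (mem_singleton x)
      (hconv {x} (singleton_subset_iff.2 hx) isCompact_singleton)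
  -- `h ((x + s • e) + t • e) → g₀ (x + s • e)`
  have h2 : Tendsto (fun t : ℝ ↦ h (x + s • e + t • e)) atTop (𝓝 (g₀ (x + s • e))) :=
    tendsto_of_tendsto_supCkENorm_sub (f := fun (t : ℝ) (y : E) ↦ h (y + t • e))
      (mem_singleton (x + s • e))
      (hconv {x + s • e} (singleton_subset_iff.2 (hOe x hx s)) isCompact_singleton)
  -- the second family is the first along `t ↦ s + t → +∞`
  have h3 : Tendsto (fun t : ℝ ↦ h (x + s • e + t • e)) atTop (𝓝 (g₀ x)) := by
    have := h1.comp (tendsto_atTop_add_const_left atTop s tendsto_id)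
    refine this.congr fun t ↦ ?_
    simp only [comp_apply, id_eq, add_smul, add_assoc]
  exact tendsto_nhds_unique h2 h3

/-- **Sup-norm form**: under the same convergence, every translate of the limit has `Cᵏ` distance
zero from the limit on every subset of `O` — the limit configuration is a REST POINT of the
translation flow in the `Cᵏ_loc` currency (the degenerate, `L`-free case of uniform recurrence).
[cite: Hale1980, Ch. I §8 Thm. 8.1] -/
theorem supCkENorm_translate_sub_self_eq_zero_of_tendsto {E : Type*} [NormedAddCommGroup E]
    [NormedSpace ℝ E] {W : Type*} [NormedAddCommGroup W] [NormedSpace ℝ W] {O : Set E} {e : E}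
    (hOe : ∀ x ∈ O, ∀ s : ℝ, x + s • e ∈ O) {k : ℕ} {h g₀ : E → W}
    (hconv : ∀ K ⊆ O, IsCompact K →
      Tendsto (fun t : ℝ ↦ supCkENorm K k (fun x ↦ h (x + t • e) - g₀ x)) atTop (𝓝 0))
    (s : ℝ) {S : Set E} (hS : S ⊆ O) (hO : IsOpen O) :
    supCkENorm S k (fun x ↦ g₀ (x + s • e) - g₀ x) = 0 := by
  have hstat := translate_eq_self_of_tendsto_supCkENorm_translate_sub hOe hconv
  have hgerm : ∀ x ∈ S, (fun y ↦ g₀ (y + s • e) - g₀ y) =ᶠ[𝓝 x] fun _ ↦ (0 : W) := by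
    intro x hx
    filter_upwards [hO.mem_nhds (hS hx)] with y hy
    rw [hstat y hy s, sub_self]
  rw [supCkENorm_congr hgerm]
  exact supCkENorm_zero S k

end Summit.FinalStateConjecture.FinalStateConjecture.Theorems.ClusterCompleteness

end
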